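/-
Copyright (c) 2026 the pub-hodgecm-mathlib formalisation cell (harness21).  Prover seat hodgecm-mathlib-K2E1-p14 (g0), Track B «K2-LIT» ENGINE E1, h413 =
`stmt-HodgeConjecture-24833`, route `HCCMUnconditional`, campaign «5Res» (b) «BL-2(χ,τ)» — (χ,τ)-EXPORTS X1_χ, dealt by K2E1-plan (g6) (125) LAST DEALS 2026-09-04T11:18:40Z
(«K2E1-p14 → `Theorems/K2E1ChiEisensteinMeromorphicExportsU2.lean` X1_χ (print of ★ p859591 over K2E1-p10's 12b) then X2_χ core»); REPORT-FIRST R1 on the K2 bus 11:27:36Z (R34: K2-lead ∕ g7).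
-/
import Summits.HodgeConjecture.HodgeConjecture.Theorems.K2E1ChiEisensteinMeromorphicBallU2   -- ★ p859726 row 12b (K2E1-p10 g2): the letters; brings ★ 11b `exists_xSystem_finDim`, `xSystem_existsUnique_of_finDim`
import Summits.HodgeConjecture.HodgeConjecture.Theorems.K2E1BLXSystemByproductsU             -- ★ p859320 (K2E1-p08 g6): the SCALAR template; brings ★ `exists_solution_byproducts`, the normal-form gluing lemmas
import HarnessLib

/-!
# h413 ∕ Track B «K2-LIT», 5Res (b) «BL-2(χ,τ)» — `K2E1ChiEisensteinMeromorphicExportsU2`, (χ,τ)-EXPORTS X1_χ §1: THE BY-PRODUCTS OF BERNSTEIN–LAPID ON ONE BALL FOR A SECTION WITH A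
# FINITE-DIMENSIONAL CONSTANT-TERM PARAMETER — the `g`-free vector solution `(vX, cc) : ℂ → 𝓗_k(𝔛) × B` on its co-discrete holomorphy set `U`, the equations and uniqueness on `U`,
# the Godement agreement, and the scalar pieces with their germs (rank-generic, letters hypothesis-first)

Cell `pub/hodgecm-mathlib`, crux H413 = `stmt-HodgeConjecture-24833`; chair K2-lead (g1) (R34 interim), dealer K2E1-plan (g6) (125).  THEOREMS ONLY (no `def`, no `instance`, no `notation`,
no named-fact hypothesis, no `sorry`); lane `--kind proof --supports stmt-HodgeConjecture-24833 --as helper` (count-neutral).  Rank-generic `(F, E, c, N)`.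

THE MATHEMATICS [BernsteinLapid2019, Thm 2.3, §2.1, §4 Claims 2–5 and p. 10; MoeglinWaldspurger1995, IV.1.8].  ★ X1 `K2E1SphericalEisensteinMeromorphicExportsU2.exists_ball_package_cm_two`
exposes the objects of the SPHERICAL per-ball chain by calling ★ `K2E1BLXSystemByproductsU.exists_xSystem_byproducts` — the by-products of the `𝔛`-system with a SCALAR constant-term
unknown `b ∈ ℂ` (`cnstN(ι ψ) = φ₀·α₁ z + b·α₂ z`, non-degeneracy `α₂ z ≠ 0`).  For a `(χ,τ)`-section the constant-term line `ℂ·[H^{1−z}]` becomes the finite-dimensional space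
`V′_{1−z} = {[f^{φ′}_{1−z}] : φ′ ∈ V(χʷ,τ,U)}` (rows 9∕11b), the unknown is `(ψ, b) ∈ 𝓗_k(𝔛) × B` with a holomorphic family `L : ℂ → (B →L 𝓗_k(Z_a))` (`L(z)b = Σ_j b_j·[f^{φ′_j}_{1−z}]`),
the constant-term equation is `cnstN(ι ψ) = φ₀·α₁ z + L z b`, and non-degeneracy is «`L z` INJECTIVE on the Godement part» — exactly the letters of ★ row 12b
`chiEisenstein_meromorphic_solution_of_letters` (which returns the packaged system `(A, cc)` and a meromorphic, eventually-unique solution `v`, but not the by-products).  THIS FILE (§1)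
is the (χ,τ) twin of ★ `exists_xSystem_byproducts`, its proof ported line by line with ★ 11b `exists_xSystem_finDim` ∕ `xSystem_existsUnique_of_finDim (hLinj)` in place of ★
`exists_xSystem` ∕ `…_of (hα₂ne)`, the Godement part `O := {σ₀ < Re}` (★ 12b's `σ₀`), and the base point of the identity-principle step taken from the uniqueness letter's `U₀ ⊆ D ∩ O`:
**`exists_chi_xSystem_byproducts`** — `∃ U vX cc`: `U ⊆ ball 0 (n+2)` open, dense, CO-DISCRETE; `vX : ℂ → 𝓗_k(𝔛)`, `cc : ℂ → B` holomorphic on `U` (`vX` meromorphic on the ball); on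
`U` the three equations `T_i(vX z) = ĥ_i(z)•vX z`, `cnstN(ι(vX z)) = φ₀•α₁ z + L z (cc z)`, `Q(vX z) = 0` hold and CHARACTERISE `(vX z, cc z)`; `(vX, cc) = (eX, bX)` on `U ∩ {σ₀ < Re}`;
and for every point-value function `Es` with functionals `Λ_i`, `Λ_i(eX z) = ĥ_i(z)·Es z` on the Godement part, a scalar piece `Ec` meromorphic on the ball, `= Es` there, eventually
`= ĥ_j⁻¹·Λ_j(vX ·)` near every `z ∈ U` with `ĥ_j(z) ≠ 0`, hence of non-negative order on `U` — the inputs of ★ row 13 ∕ X2_χ (`exists_global_pole_set[_of_lt]`) and of row 15 ∕ (c) FILE 2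
(local `𝓗_k`-boundedness = continuity of `vX` on `U`; the continued constant-term PARAMETER `cc : U → B`); ED. 2 **`exists_chi_xSystem_byproducts'`** keeps moreover the
MEROMORPHY OF `cc` ON THE BALL (`cc = snd ∘ v`), the input of X2_χ's coefficient gluing.  §2 (ED. 3, after the (χ,τ) payers land: the `HN`-holomorphy of
`z ↦ [φH^z]`, `[φ′_jH^{1−z}]`, row 12c) will be the CM ASSEMBLY `exists_chi_ball_package_cm_two` with the objects exposed as in ★ X1.
HONEST LABEL: HC_CM is proved only modulo the 7 printed citations (2 remaining named inputs: hLiu418 = `stmt-HodgeConjecture-24832`, h413 = `stmt-HodgeConjecture-24833`) until rung 0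
closes; this file asserts no named fact and closes no socket; count-neutral.  NOT claimed: location of poles, functional equation, the Hom-valued (general Hecke-matrix) edition.

## References
* [BernsteinLapid2019] J. Bernstein, E. Lapid, *On the meromorphic continuation of Eisenstein series*, J. Amer. Math. Soc. 37 (2024) (arXiv:1911.02342), Thm 2.3, §2.1, §4 Claims 2–5, p. 10.
* [MoeglinWaldspurger1995] C. Mœglin, J.-L. Waldspurger, *Spectral Decomposition and Eisenstein Series* (1995), IV.1.8–IV.1.10.
* [ReedSimonI1980] M. Reed, B. Simon, *Methods of Modern Mathematical Physics I* (1980), Thm. VI.14 (analytic Fredholm theorem).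
-/

set_option autoImplicit false
-- the mandated namespace repeats `HodgeConjecture.HodgeConjecture`, as in every `Theorems/*.lean` of this sub-problem
set_option linter.dupNamespace false

noncomputable section

open MeasureTheory Filter Topology Set Submodule NumberField
open scoped NNReal ENNReal Classical
open Literature.NumberTheory.Automorphic Literature.NumberTheory.Automorphic.UnitaryGroup AdelicGroupData
open Summit.HodgeConjecture.HodgeConjecture.Cruxes.H413.K2E1BorelEisensteinU
open Summit.HodgeConjecture.HodgeConjecture.Cruxes.H413.K2E1BLBorelSpacesU2Defs
open Summit.HodgeConjecture.HodgeConjecture.Cruxes.H413.K2E1BLBorelOperatorsU2Defs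
open Summit.HodgeConjecture.HodgeConjecture.Cruxes.H413.K2E1BLMeromorphicGluing (meromorphicOn_scalarisation toMeromorphicNFOn_eqOn_of_eventuallyEq)
open Summit.HodgeConjecture.HodgeConjecture.Cruxes.H413.K2E1MeromorphicSolutionPrincipleLocal (eventually_ne_zero_of_analyticOnNhd exists_mem_ne_zero_of_isOpen)
open Summit.HodgeConjecture.HodgeConjecture.Cruxes.H413.K2E1BLXSystemPackageFinDimU (exists_xSystem_finDim xSystem_existsUnique_of_finDim)
open Summit.HodgeConjecture.HodgeConjecture.Cruxes.H413.K2E1SphericalHeckeEigenSectionU2 (differentiable_integral_mul_borelHeight_cpow)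
open Summit.HodgeConjecture.HodgeConjecture.Cruxes.H413.K2E1SphericalEisensteinMeromorphicBallU2 (piN_comp_restrHN_comp_iota isCompactOperator_deltaShift_comp_one_sub_cnstN)
open Summit.HodgeConjecture.HodgeConjecture.Cruxes.H413.K2E1BLMeromorphicFamilyByproductsU (exists_solution_byproducts)

namespace Summit.HodgeConjecture.HodgeConjecture.Cruxes.H413.K2E1ChiEisensteinMeromorphicExportsU2

variable {F E : Type} [Field F] [NumberField F] [Field E] [NumberField E] [Algebra F E] {c : E ≃ₐ[F] E} {N : ℕ} [NeZero N]
variable [MeasurableSpace (quasiSplit F E c N).Adelic] [BorelSpace (quasiSplit F E c N).Adelic]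

/-! ## §1 The by-products of Bernstein–Lapid on one ball, finite-dimensional constant-term parameter (letters of ★ row 12b) -/

/-- **THE BY-PRODUCTS OF BERNSTEIN–LAPID ON ONE BALL FOR A SECTION WITH A FINITE-DIMENSIONAL CONSTANT-TERM PARAMETER** (rank `N`; letters = ★ row 12b
`chiEisenstein_meromorphic_solution_of_letters`'s VERBATIM, i.e. ★ P8 §2's with `(α₂, hα₂ne, b ∈ ℂ)` replaced by `(L, hLinj, b ∈ B)` and the Godement part `{σ₀ < Re}`).  `∃ U vX cc`:
`U ⊆ ball 0 (n+2)` open, dense and CO-DISCRETE in the ball; `vX : ℂ → 𝓗_k(𝔛)`, `cc : ℂ → B` holomorphic on `U` (`vX` meromorphic on the ball); on `U` the three equations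
`T_i(vX z) = ĥ_i(z)•vX z`, `cnstN (ι (vX z)) = φ₀•α₁ z + L z (cc z)`, `Q (vX z) = 0` hold and characterise `(vX z, cc z)`; `(vX, cc) = (eX, bX)` on `U ∩ {σ₀ < re}`; and for every
`Es : ℂ → ℂ` and functionals `Λ_i` with `Λ_i (eX z) = ĥ_i(z)·Es z` on the Godement part of the ball there is a scalar piece `Ec`, meromorphic on the ball, `= Es` on its Godement part,
eventually `= ĥ_j⁻¹·Λ_j(vX ·)` near every `z ∈ U` with `ĥ_j(z) ≠ 0`, hence of non-negative order at every point of `U` — the (χ,τ) twin of ★ `exists_xSystem_byproducts`, same proof over ★ 11b.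
[cite: BernsteinLapid2019, Thm 2.3, §2.1 and §4 p. 10] [cite: ReedSimonI1980, Thm. VI.14] -/
theorem exists_chi_xSystem_byproducts (σ₀ : ℝ) (n k : ℕ) {μ : Measure (quasiSplit F E c N).automorphicQuotient}
    {μZ : Measure (borelQuotient F E c N)} (νG : Measure (quasiSplit F E c N).Adelic) [IsFiniteMeasureOnCompacts νG]
    -- levels and the ι-package
    {I : Type} [Fintype I] {a : ℝ≥0} (ha : 0 < a) {a₀ : I → ℝ≥0} (haa₀ : ∀ i, a ≤ a₀ i)
    [hfin₀ : ∀ i, IsFiniteMeasure (weightedTruncMeasure F E c N k (a₀ i) μZ)] (hb : IotaBound F E c N k a μ μZ) (hb₀ : ∀ i, IotaBound F E c N k (a₀ i) μ μZ)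
    (hcl₀ : ∀ i, IsClosed ((LinearMap.range (iota (hb₀ i)).toLinearMap : Submodule ℂ (HN F E c N k (a₀ i) μZ)) : Set (HN F E c N k (a₀ i) μZ)))
    (hinj₀ : ∀ i, Function.Injective (iota (hb₀ i)))
    -- the good test functions and their transforms
    (h : I → (quasiSplit F E c N).Adelic → ℂ) (hhc : ∀ i, Continuous (h i)) (hhs : ∀ i, HasCompactSupport (h i))
    (hcov : ∀ z ∈ Metric.ball (0 : ℂ) (n + 2), ∃ i, (∫ x, h i x * (((borelHeight x : ℝ≥0) : ℝ) : ℂ) ^ z ∂νG) ≠ 0)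
    -- the `Z`-side Hecke operators (★ `ShiftBound`) and K2's decay letters
    (hs : ∀ i, ShiftBound F E c N k a (a₀ i) νG μZ (h i)) {m C : I → ℝ} (hm : ∀ i, 0 ≤ m i) (hC : ∀ i, 0 ≤ C i)
    (hK1 : ∀ i, ∀ f : HNcusp F E c N k a μZ, ∀ᵐ z ∂(weightedTruncMeasure F E c N k (a₀ i) μZ),
      ‖rightConvFun F E c N νG (h i) ((f : HN F E c N k a μZ) : borelQuotient F E c N → ℂ) z‖ ≤ C i * ‖f‖ * ((borelQuotHeight F E c N z : ℝ)) ^ (-m i))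
    -- the `𝔛`-side Hecke operators and the intertwining (P3-C)
    (T : I → HX F E c N k μ →L[ℂ] HX F E c N k μ) (hδι : ∀ i, deltaShift (hs i) ∘L iota hb = restrHN F E c N k (haa₀ i) μZ ∘L iota hb ∘L T i)
    -- the constant-term data: `α₁` (`[f_z^φ]`) and the finite-dimensional family `L` (`b ↦ Σ_j b_j [f^{φ′_j}_{ρ₀−z}]`), holomorphic on the ball, `L z` injective on the Godement part; `Q`
    {α₁ : ℂ → HN F E c N k a μZ} (hα₁d : DifferentiableOn ℂ α₁ (Metric.ball (0 : ℂ) (n + 2)))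
    {B : Type*} [NormedAddCommGroup B] [NormedSpace ℂ B] [FiniteDimensional ℂ B] {L : ℂ → B →L[ℂ] HN F E c N k a μZ} (hL : DifferentiableOn ℂ L (Metric.ball (0 : ℂ) (n + 2)))
    (hLinj : ∀ z ∈ Metric.ball (0 : ℂ) (n + 2), σ₀ < z.re → Function.Injective (L z))
    {X' : Type} [NormedAddCommGroup X'] [NormedSpace ℂ X'] [CompleteSpace X'] (Q : HX F E c N k μ →L[ℂ] X') (φ₀ : ℂ)
    -- the Eisenstein data in `𝓗_k(𝔛) × B` on the Godement part `{σ₀ < Re z}` of the ball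
    (eX : ℂ → HX F E c N k μ) (bX : ℂ → B)
    (hsolT : ∀ z ∈ Metric.ball (0 : ℂ) (n + 2), σ₀ < z.re → ∀ i, T i (eX z) = (∫ x, h i x * (((borelHeight x : ℝ≥0) : ℝ) : ℂ) ^ z ∂νG) • eX z)
    (hsolC : ∀ z ∈ Metric.ball (0 : ℂ) (n + 2), σ₀ < z.re → cnstN F E c N k a μZ (iota hb (eX z)) = φ₀ • α₁ z + L z (bX z))
    (hsolQ : ∀ z ∈ Metric.ball (0 : ℂ) (n + 2), σ₀ < z.re → Q (eX z) = 0)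
    -- uniqueness of the `ψ`-component on an open non-empty part of the Godement set (row 12a∕12c's letter)
    (hunq : ∃ U₀ : Set ℂ, IsOpen U₀ ∧ U₀.Nonempty ∧ U₀ ⊆ Metric.ball (0 : ℂ) (n + 2) ∩ {z : ℂ | σ₀ < z.re} ∧
      ∀ z ∈ U₀, ∀ (ψ : HX F E c N k μ) (b : B), (∀ i, T i ψ = (∫ x, h i x * (((borelHeight x : ℝ≥0) : ℝ) : ℂ) ^ z ∂νG) • ψ) →
        cnstN F E c N k a μZ (iota hb ψ) = φ₀ • α₁ z + L z b → Q ψ = 0 → ψ = eX z) :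
    ∃ (U : Set ℂ) (vX : ℂ → HX F E c N k μ) (cc : ℂ → B),
      IsOpen U ∧ U ⊆ Metric.ball (0 : ℂ) (n + 2) ∧ Metric.ball (0 : ℂ) (n + 2) ⊆ closure U ∧ (∀ z₀ ∈ Metric.ball (0 : ℂ) (n + 2), ∀ᶠ s in 𝓝[≠] z₀, s ∈ U) ∧
      DifferentiableOn ℂ vX U ∧ MeromorphicOn vX (Metric.ball (0 : ℂ) (n + 2)) ∧ DifferentiableOn ℂ cc U ∧
      (∀ z ∈ U, (∀ i, T i (vX z) = (∫ x, h i x * (((borelHeight x : ℝ≥0) : ℝ) : ℂ) ^ z ∂νG) • vX z) ∧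
        cnstN F E c N k a μZ (iota hb (vX z)) = φ₀ • α₁ z + L z (cc z) ∧ Q (vX z) = 0) ∧
      (∀ z ∈ U, ∀ (ψ : HX F E c N k μ) (b : B), (∀ i, T i ψ = (∫ x, h i x * (((borelHeight x : ℝ≥0) : ℝ) : ℂ) ^ z ∂νG) • ψ) →
        cnstN F E c N k a μZ (iota hb ψ) = φ₀ • α₁ z + L z b → Q ψ = 0 → ψ = vX z ∧ b = cc z) ∧
      (∀ z ∈ U, σ₀ < z.re → vX z = eX z ∧ cc z = bX z) ∧
      ∀ (Es : ℂ → ℂ) (Λ : I → HX F E c N k μ →L[ℂ] ℂ),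
        (∀ i, ∀ z ∈ Metric.ball (0 : ℂ) (n + 2), σ₀ < z.re → Λ i (eX z) = (∫ x, h i x * (((borelHeight x : ℝ≥0) : ℝ) : ℂ) ^ z ∂νG) * Es z) →
        ∃ Ec : ℂ → ℂ, MeromorphicOn Ec (Metric.ball (0 : ℂ) (n + 2)) ∧ (∀ z ∈ Metric.ball (0 : ℂ) (n + 2), σ₀ < z.re → Ec z = Es z) ∧
          (∀ j, ∀ z ∈ U, (∫ x, h j x * (((borelHeight x : ℝ≥0) : ℝ) : ℂ) ^ z ∂νG) ≠ 0 →
            Ec =ᶠ[𝓝[≠] z] fun s => (∫ x, h j x * (((borelHeight x : ℝ≥0) : ℝ) : ℂ) ^ s ∂νG)⁻¹ * Λ j (vX s)) ∧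
          ∀ z ∈ U, 0 ≤ meromorphicOrderAt Ec z := by
  -- abbreviations
  set D : Set ℂ := Metric.ball (0 : ℂ) (n + 2) with hDdef
  set O : Set ℂ := {z : ℂ | σ₀ < z.re} with hOdef
  set ĥ : I → ℂ → ℂ := fun i z => ∫ x, h i x * (((borelHeight x : ℝ≥0) : ℝ) : ℂ) ^ z ∂νG with hĥdef
  have hD : IsOpen D := Metric.isOpen_ball
  have hDc : IsPreconnected D := (convex_ball (0 : ℂ) _).isPreconnected
  have hO : IsOpen O := isOpen_lt continuous_const Complex.continuous_re
  -- holomorphy of the transforms (verbatim ★ P8 §2); `α₁`, `L` are holomorphic by hypothesis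
  have hĥd : ∀ i, DifferentiableOn ℂ (ĥ i) D := fun i => (differentiable_integral_mul_borelHeight_cpow νG (hhc i) (hhs i)).differentiableOn
  have hĥa : ∀ i, AnalyticOnNhd ℂ (ĥ i) D := fun i => (hĥd i).analyticOnNhd hD
  -- the packaged `𝔛`-system with a finite-dimensional parameter (★ row 11b `exists_xSystem_finDim`) — `g`-free
  haveI : CompleteSpace B := FiniteDimensional.complete ℂ B
  haveI : CompleteSpace ((I → HX F E c N k μ) × (HN F E c N k a μZ × X')) := inferInstance
  obtain ⟨A, c𝓦, hA, hc𝓦, hchar, hfinT⟩ := exists_xSystem_finDim (V₀ := fun i => HN F E c N k (a₀ i) μZ) hD T hĥd hcov (iota hb) (cnstN F E c N k a μZ) Q hα₁d hL φ₀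
    (fun i => deltaShift (hs i)) (fun i => restrHN F E c N k (haa₀ i) μZ) (fun i => piN (hb₀ i) (hcl₀ i) (hinj₀ i)) hδι
    (fun i => piN_comp_restrHN_comp_iota (haa₀ i) hb (hb₀ i) (hcl₀ i) (hinj₀ i))
    (fun i => isCompactOperator_deltaShift_comp_one_sub_cnstN (lt_of_lt_of_le ha (haa₀ i)) (hs i) (hm i) (hC i) (hK1 i))
  -- existence on the Godement set, uniqueness on `U₀`
  have hsol : ∀ z ∈ D ∩ O, A z ((fun z => (eX z, bX z)) z) = c𝓦 z := fun z hz =>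
    (hchar z (eX z) (bX z)).2 ⟨hsolT z hz.1 hz.2, hsolC z hz.1 hz.2, hsolQ z hz.1 hz.2⟩
  obtain ⟨U₀, hU₀o, ⟨x₀, hx₀⟩, hU₀D, hU₀unq⟩ := hunq
  have hx : x₀ ∈ D ∩ O := hU₀D hx₀
  have hunq' : ∃ U₀ : Set ℂ, IsOpen U₀ ∧ U₀.Nonempty ∧ U₀ ⊆ D ∩ O ∧ ∀ z ∈ U₀, ∀ w : HX F E c N k μ × B, A z w = c𝓦 z → w = (fun z => (eX z, bX z)) z := by
    refine ⟨U₀, hU₀o, ⟨x₀, hx₀⟩, hU₀D, fun z hz w hw => ?_⟩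
    have hex : ∃! x : HX F E c N k μ × B, A z x = c𝓦 z :=
      xSystem_existsUnique_of_finDim hchar (hLinj z (hU₀D hz).1 (hU₀D hz).2) (hsol z (hU₀D hz)) fun ψ b hψb =>
        hU₀unq z hz ψ b ((hchar z ψ b).1 hψb).1 ((hchar z ψ b).1 hψb).2.1 ((hchar z ψ b).1 hψb).2.2
    exact hex.unique hw (hsol z (hU₀D hz))
  -- Thm 2.3 with the holomorphy set kept
  obtain ⟨v, U, hUo, hUD, hcl, hUcd, hvU, hvmer, hsolU, hve⟩ := exists_solution_byproducts hD hDc hA hc𝓦 hfinT hsol hunq'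
  -- the components
  have hfst : ∀ z, (v z).1 = (ContinuousLinearMap.fst ℂ (HX F E c N k μ) B) (v z) := fun z => rfl
  have hsnd : ∀ z, (v z).2 = (ContinuousLinearMap.snd ℂ (HX F E c N k μ) B) (v z) := fun z => rfl
  have hvXd : DifferentiableOn ℂ (fun z => (v z).1) U := (ContinuousLinearMap.fst ℂ (HX F E c N k μ) B).differentiable.comp_differentiableOn hvU
  have hccd : DifferentiableOn ℂ (fun z => (v z).2) U := (ContinuousLinearMap.snd ℂ (HX F E c N k μ) B).differentiable.comp_differentiableOn hvU
  have hvXm : MeromorphicOn (fun z => (v z).1) D := fun z hz => (ContinuousLinearMap.fst ℂ (HX F E c N k μ) B).comp_meromorphicAt (hvmer z hz)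
  -- the equations on `U` and uniqueness there
  have hsolv : ∀ z ∈ U, A z (v z) = c𝓦 z := fun z hz => (hsolU z hz (v z)).2 rfl
  have heqs : ∀ z ∈ U, (∀ i, T i (v z).1 = ĥ i z • (v z).1) ∧ cnstN F E c N k a μZ (iota hb (v z).1) = φ₀ • α₁ z + L z (v z).2 ∧ Q (v z).1 = 0 :=
    fun z hz => (hchar z (v z).1 (v z).2).1 (hsolv z hz)
  refine ⟨U, fun z => (v z).1, fun z => (v z).2, hUo, hUD, hcl, hUcd, hvXd, hvXm, hccd, heqs, fun z hz ψ b h1 h2 h3 => ?_, fun z hz hz1 => ?_, fun Es Λ hΛ => ?_⟩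
  · have hw : (ψ, b) = v z := (hsolU z hz (ψ, b)).1 ((hchar z ψ b).2 ⟨h1, h2, h3⟩)
    exact ⟨congrArg Prod.fst hw, congrArg Prod.snd hw⟩
  · have hw : v z = (eX z, bX z) := hve z ⟨hz, hz1⟩
    exact ⟨congrArg Prod.fst hw, congrArg Prod.snd hw⟩
  -- the scalar piece: scalarise through an index `j₀` with `ĥ_{j₀}(0) ≠ 0`
  have h0D : (0 : ℂ) ∈ D := by rw [hDdef]; exact Metric.mem_ball_self (by positivity)
  obtain ⟨j₀, hj₀⟩ := hcov 0 h0D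
  have hĥc : ∀ j, Continuous (ĥ j) := fun j => (differentiable_integral_mul_borelHeight_cpow νG (hhc j) (hhs j)).continuous
  have hvXU : ∀ s ∈ U, σ₀ < s.re → (v s).1 = eX s := fun s hs hs1 => congrArg Prod.fst (hve s ⟨hs, hs1⟩)
  -- the local analytic germs `g_j := ĥ_j⁻¹ · Λ_j ∘ vX`, analytic on `U ∩ {ĥ_j ≠ 0}`, `= Es` on `U ∩ O` there
  have hgerm : ∀ j, ∀ z ∈ U, ĥ j z ≠ 0 → AnalyticAt ℂ (fun s => (ĥ j s)⁻¹ * Λ j (v s).1) z := by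
    intro j z hz hjz
    have hva : AnalyticAt ℂ v z := hvU.analyticAt (hUo.mem_nhds hz)
    have h2 : AnalyticAt ℂ (fun s => Λ j (v s).1) z := ((Λ j ∘L ContinuousLinearMap.fst ℂ (HX F E c N k μ) B).analyticAt (v z)).comp hva
    exact ((hĥa j z (hUD hz)).inv hjz).mul h2
  have hEq : ∀ j, ∀ s ∈ U, s ∈ D → σ₀ < s.re → ĥ j s ≠ 0 → (ĥ j s)⁻¹ * Λ j (v s).1 = Es s := by
    intro j s hsU hsD hs1 hjs
    rw [hvXU s hsU hs1, hΛ j s hsD hs1, inv_mul_cancel_left₀ hjs]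
  -- the scalarisations `S j`, meromorphic on `D` as soon as `ĥ_j ≢ 0`
  have hSmer : ∀ j, ∀ z₁ ∈ D, ĥ j z₁ ≠ 0 → MeromorphicOn (fun z => if z ∈ O then Es z else (ĥ j z)⁻¹ * Λ j (v z).1) D := by
    intro j z₁ hz₁ hjz₁
    refine meromorphicOn_scalarisation hvXm (Λ j) (hĥa j).meromorphicOn Es fun z₀ hz₀ => ?_
    filter_upwards [hUcd z₀ hz₀, eventually_ne_zero_of_analyticOnNhd hDc (hĥa j) hz₁ hjz₁ hz₀, mem_nhdsWithin_of_mem_nhds (hD.mem_nhds hz₀)] with s hsU hĥs hsD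
    intro hsO
    exact ⟨hĥs, by rw [hvXU s hsU hsO, hΛ j s hsD hsO]⟩
  -- near a point of `U` where `ĥ_j ≠ 0`, every `S j'` (with `ĥ_{j'} ≢ 0`) is eventually the germ `g_j`
  have hloc : ∀ j', ∀ z₁' ∈ D, ĥ j' z₁' ≠ 0 → ∀ j, ∀ z ∈ U, ĥ j z ≠ 0 →
      (fun z => if z ∈ O then Es z else (ĥ j' z)⁻¹ * Λ j' (v z).1) =ᶠ[𝓝[≠] z] fun s => (ĥ j s)⁻¹ * Λ j (v s).1 := by
    intro j' z₁' hz₁' hj'z₁' j z hz hjz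
    -- a base point `z₁ ∈ U ∩ (D ∩ O)` with `ĥ_j(z₁) ≠ 0` (`D ∩ O` is non-empty: it contains `U₀ ∋ x₀`)
    have hVo : IsOpen ((D ∩ O) ∩ U) := (hD.inter hO).inter hUo
    have hVne : ((D ∩ O) ∩ U).Nonempty := mem_closure_iff_nhds.1 (hcl hx.1) _ ((hD.inter hO).mem_nhds hx)
    obtain ⟨z₁, hz₁V, hjz₁⟩ := exists_mem_ne_zero_of_isOpen hDc (hĥa j) (hUD hz) hjz hVo (fun s hs => hs.1.1) hVne
    -- both pieces equal `Es` near `z₁`, and the germ `g_j` equals `Es` there too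
    have hWo : IsOpen (((D ∩ O) ∩ U) ∩ {s | ĥ j s ≠ 0}) := hVo.inter (isOpen_ne_fun (hĥc j) continuous_const)
    have hW1 : ((D ∩ O) ∩ U) ∩ {s | ĥ j s ≠ 0} ∈ 𝓝 z₁ := hWo.mem_nhds ⟨hz₁V, hjz₁⟩
    have hgerm₁ : AnalyticAt ℂ (fun s => (ĥ j s)⁻¹ * Λ j (v s).1) z₁ := hgerm j z₁ hz₁V.2 hjz₁
    have hf : (fun z => if z ∈ O then Es z else (ĥ j' z)⁻¹ * Λ j' (v z).1) =ᶠ[𝓝 z₁] fun s => (ĥ j s)⁻¹ * Λ j (v s).1 := by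
      filter_upwards [hW1] with s hs
      rw [if_pos hs.1.1.2, hEq j s hs.1.2 hs.1.1.1 hs.1.1.2 hs.2]
    have hf' : (fun z => if z ∈ O then Es z else (ĥ j z)⁻¹ * Λ j (v z).1) =ᶠ[𝓝 z₁] fun s => (ĥ j s)⁻¹ * Λ j (v s).1 := by
      filter_upwards [hW1] with s hs
      rw [if_pos hs.1.1.2, hEq j s hs.1.2 hs.1.1.1 hs.1.1.2 hs.2]
    have hNF := toMeromorphicNFOn_eqOn_of_eventuallyEq (subset_refl D) hDc (hSmer j' z₁' hz₁' hj'z₁') (hSmer j z (hUD hz) hjz) hz₁V.1.1 hgerm₁ hf hf'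
    -- near `z`: `S j' = NF(S j') = NF(S j) = S j = g_j`
    have h1 : (fun z => if z ∈ O then Es z else (ĥ j' z)⁻¹ * Λ j' (v z).1) =ᶠ[𝓝[≠] z]
        toMeromorphicNFOn (fun z => if z ∈ O then Es z else (ĥ j' z)⁻¹ * Λ j' (v z).1) D :=
      ((hSmer j' z₁' hz₁' hj'z₁').toMeromorphicNFOn_eq_self_on_nhdsNE (hUD hz)).symm
    have h2 : toMeromorphicNFOn (fun z => if z ∈ O then Es z else (ĥ j' z)⁻¹ * Λ j' (v z).1) D =ᶠ[𝓝[≠] z]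
        toMeromorphicNFOn (fun z => if z ∈ O then Es z else (ĥ j z)⁻¹ * Λ j (v z).1) D :=
      (eventually_of_mem (hD.mem_nhds (hUD hz)) hNF).filter_mono nhdsWithin_le_nhds
    have h3 : toMeromorphicNFOn (fun z => if z ∈ O then Es z else (ĥ j z)⁻¹ * Λ j (v z).1) D =ᶠ[𝓝[≠] z]
        (fun z => if z ∈ O then Es z else (ĥ j z)⁻¹ * Λ j (v z).1) :=
      (hSmer j z (hUD hz) hjz).toMeromorphicNFOn_eq_self_on_nhdsNE (hUD hz)
    have h4 : (fun z => if z ∈ O then Es z else (ĥ j z)⁻¹ * Λ j (v z).1) =ᶠ[𝓝[≠] z] fun s => (ĥ j s)⁻¹ * Λ j (v s).1 := by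
      refine (eventually_of_mem ((hUo.inter ((isOpen_ne_fun (hĥc j) continuous_const).inter hD)).mem_nhds ⟨hz, hjz, hUD hz⟩) fun s hs => ?_).filter_mono
        nhdsWithin_le_nhds
      show (if s ∈ O then Es s else (ĥ j s)⁻¹ * Λ j (v s).1) = (ĥ j s)⁻¹ * Λ j (v s).1
      by_cases hsO : s ∈ O
      · rw [if_pos hsO, hEq j s hs.1 hs.2.2 hsO hs.2.1]
      · rw [if_neg hsO]
    exact ((h1.trans h2).trans h3).trans h4
  refine ⟨fun z => if z ∈ O then Es z else (ĥ j₀ z)⁻¹ * Λ j₀ (v z).1, hSmer j₀ 0 h0D hj₀, fun z _ hz1 => by simp only [if_pos (show z ∈ O from hz1)],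
    fun j z hz hjz => hloc j₀ 0 h0D hj₀ j z hz hjz, fun z hz => ?_⟩
  obtain ⟨j, hjz⟩ := hcov z (hUD hz)
  rw [meromorphicOrderAt_congr (hloc j₀ 0 h0D hj₀ j z hz hjz)]
  exact (hgerm j z hz hjz).meromorphicOrderAt_nonneg

/-! ## §1 ED. 2: the parameter `cc` is meromorphic on the ball -/

/-- **ED. 2 — THE SAME BY-PRODUCTS WITH THE MEROMORPHY OF THE CONTINUED PARAMETER `cc` ON THE BALL KEPT** (the input of the coefficient gluing of X2_χ: `cc = snd ∘ v` for the
meromorphic solution `v` of ★ `exists_solution_byproducts`, so `cc` is meromorphic on `ball 0 (n+2)` — the (χ,τ) counterpart of ★ X2a §1 `meromorphicOn_coeff_of_system`, which had to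
recover it for the scalar coefficient after the fact).  Statement = §1's with the extra clause `MeromorphicOn cc (ball 0 (n+2))`; same proof.
[cite: BernsteinLapid2019, Thm 2.3, §2.1 and §4 p. 10] [cite: ReedSimonI1980, Thm. VI.14] -/
theorem exists_chi_xSystem_byproducts' (σ₀ : ℝ) (n k : ℕ) {μ : Measure (quasiSplit F E c N).automorphicQuotient}
    {μZ : Measure (borelQuotient F E c N)} (νG : Measure (quasiSplit F E c N).Adelic) [IsFiniteMeasureOnCompacts νG]
    -- levels and the ι-package
    {I : Type} [Fintype I] {a : ℝ≥0} (ha : 0 < a) {a₀ : I → ℝ≥0} (haa₀ : ∀ i, a ≤ a₀ i)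
    [hfin₀ : ∀ i, IsFiniteMeasure (weightedTruncMeasure F E c N k (a₀ i) μZ)] (hb : IotaBound F E c N k a μ μZ) (hb₀ : ∀ i, IotaBound F E c N k (a₀ i) μ μZ)
    (hcl₀ : ∀ i, IsClosed ((LinearMap.range (iota (hb₀ i)).toLinearMap : Submodule ℂ (HN F E c N k (a₀ i) μZ)) : Set (HN F E c N k (a₀ i) μZ)))
    (hinj₀ : ∀ i, Function.Injective (iota (hb₀ i)))
    -- the good test functions and their transforms
    (h : I → (quasiSplit F E c N).Adelic → ℂ) (hhc : ∀ i, Continuous (h i)) (hhs : ∀ i, HasCompactSupport (h i))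
    (hcov : ∀ z ∈ Metric.ball (0 : ℂ) (n + 2), ∃ i, (∫ x, h i x * (((borelHeight x : ℝ≥0) : ℝ) : ℂ) ^ z ∂νG) ≠ 0)
    -- the `Z`-side Hecke operators (★ `ShiftBound`) and K2's decay letters
    (hs : ∀ i, ShiftBound F E c N k a (a₀ i) νG μZ (h i)) {m C : I → ℝ} (hm : ∀ i, 0 ≤ m i) (hC : ∀ i, 0 ≤ C i)
    (hK1 : ∀ i, ∀ f : HNcusp F E c N k a μZ, ∀ᵐ z ∂(weightedTruncMeasure F E c N k (a₀ i) μZ),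
      ‖rightConvFun F E c N νG (h i) ((f : HN F E c N k a μZ) : borelQuotient F E c N → ℂ) z‖ ≤ C i * ‖f‖ * ((borelQuotHeight F E c N z : ℝ)) ^ (-m i))
    -- the `𝔛`-side Hecke operators and the intertwining (P3-C)
    (T : I → HX F E c N k μ →L[ℂ] HX F E c N k μ) (hδι : ∀ i, deltaShift (hs i) ∘L iota hb = restrHN F E c N k (haa₀ i) μZ ∘L iota hb ∘L T i)
    -- the constant-term data: `α₁` (`[f_z^φ]`) and the finite-dimensional family `L` (`b ↦ Σ_j b_j [f^{φ′_j}_{ρ₀−z}]`), holomorphic on the ball, `L z` injective on the Godement part; `Q`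
    {α₁ : ℂ → HN F E c N k a μZ} (hα₁d : DifferentiableOn ℂ α₁ (Metric.ball (0 : ℂ) (n + 2)))
    {B : Type*} [NormedAddCommGroup B] [NormedSpace ℂ B] [FiniteDimensional ℂ B] {L : ℂ → B →L[ℂ] HN F E c N k a μZ} (hL : DifferentiableOn ℂ L (Metric.ball (0 : ℂ) (n + 2)))
    (hLinj : ∀ z ∈ Metric.ball (0 : ℂ) (n + 2), σ₀ < z.re → Function.Injective (L z))
    {X' : Type} [NormedAddCommGroup X'] [NormedSpace ℂ X'] [CompleteSpace X'] (Q : HX F E c N k μ →L[ℂ] X') (φ₀ : ℂ)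
    -- the Eisenstein data in `𝓗_k(𝔛) × B` on the Godement part `{σ₀ < Re z}` of the ball
    (eX : ℂ → HX F E c N k μ) (bX : ℂ → B)
    (hsolT : ∀ z ∈ Metric.ball (0 : ℂ) (n + 2), σ₀ < z.re → ∀ i, T i (eX z) = (∫ x, h i x * (((borelHeight x : ℝ≥0) : ℝ) : ℂ) ^ z ∂νG) • eX z)
    (hsolC : ∀ z ∈ Metric.ball (0 : ℂ) (n + 2), σ₀ < z.re → cnstN F E c N k a μZ (iota hb (eX z)) = φ₀ • α₁ z + L z (bX z))
    (hsolQ : ∀ z ∈ Metric.ball (0 : ℂ) (n + 2), σ₀ < z.re → Q (eX z) = 0)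
    -- uniqueness of the `ψ`-component on an open non-empty part of the Godement set (row 12a∕12c's letter)
    (hunq : ∃ U₀ : Set ℂ, IsOpen U₀ ∧ U₀.Nonempty ∧ U₀ ⊆ Metric.ball (0 : ℂ) (n + 2) ∩ {z : ℂ | σ₀ < z.re} ∧
      ∀ z ∈ U₀, ∀ (ψ : HX F E c N k μ) (b : B), (∀ i, T i ψ = (∫ x, h i x * (((borelHeight x : ℝ≥0) : ℝ) : ℂ) ^ z ∂νG) • ψ) →
        cnstN F E c N k a μZ (iota hb ψ) = φ₀ • α₁ z + L z b → Q ψ = 0 → ψ = eX z) :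
    ∃ (U : Set ℂ) (vX : ℂ → HX F E c N k μ) (cc : ℂ → B),
      IsOpen U ∧ U ⊆ Metric.ball (0 : ℂ) (n + 2) ∧ Metric.ball (0 : ℂ) (n + 2) ⊆ closure U ∧ (∀ z₀ ∈ Metric.ball (0 : ℂ) (n + 2), ∀ᶠ s in 𝓝[≠] z₀, s ∈ U) ∧
      DifferentiableOn ℂ vX U ∧ MeromorphicOn vX (Metric.ball (0 : ℂ) (n + 2)) ∧ DifferentiableOn ℂ cc U ∧ MeromorphicOn cc (Metric.ball (0 : ℂ) (n + 2)) ∧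
      (∀ z ∈ U, (∀ i, T i (vX z) = (∫ x, h i x * (((borelHeight x : ℝ≥0) : ℝ) : ℂ) ^ z ∂νG) • vX z) ∧
        cnstN F E c N k a μZ (iota hb (vX z)) = φ₀ • α₁ z + L z (cc z) ∧ Q (vX z) = 0) ∧
      (∀ z ∈ U, ∀ (ψ : HX F E c N k μ) (b : B), (∀ i, T i ψ = (∫ x, h i x * (((borelHeight x : ℝ≥0) : ℝ) : ℂ) ^ z ∂νG) • ψ) →
        cnstN F E c N k a μZ (iota hb ψ) = φ₀ • α₁ z + L z b → Q ψ = 0 → ψ = vX z ∧ b = cc z) ∧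
      (∀ z ∈ U, σ₀ < z.re → vX z = eX z ∧ cc z = bX z) ∧
      ∀ (Es : ℂ → ℂ) (Λ : I → HX F E c N k μ →L[ℂ] ℂ),
        (∀ i, ∀ z ∈ Metric.ball (0 : ℂ) (n + 2), σ₀ < z.re → Λ i (eX z) = (∫ x, h i x * (((borelHeight x : ℝ≥0) : ℝ) : ℂ) ^ z ∂νG) * Es z) →
        ∃ Ec : ℂ → ℂ, MeromorphicOn Ec (Metric.ball (0 : ℂ) (n + 2)) ∧ (∀ z ∈ Metric.ball (0 : ℂ) (n + 2), σ₀ < z.re → Ec z = Es z) ∧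
          (∀ j, ∀ z ∈ U, (∫ x, h j x * (((borelHeight x : ℝ≥0) : ℝ) : ℂ) ^ z ∂νG) ≠ 0 →
            Ec =ᶠ[𝓝[≠] z] fun s => (∫ x, h j x * (((borelHeight x : ℝ≥0) : ℝ) : ℂ) ^ s ∂νG)⁻¹ * Λ j (vX s)) ∧
          ∀ z ∈ U, 0 ≤ meromorphicOrderAt Ec z := by
  -- abbreviations
  set D : Set ℂ := Metric.ball (0 : ℂ) (n + 2) with hDdef
  set O : Set ℂ := {z : ℂ | σ₀ < z.re} with hOdef
  set ĥ : I → ℂ → ℂ := fun i z => ∫ x, h i x * (((borelHeight x : ℝ≥0) : ℝ) : ℂ) ^ z ∂νG with hĥdef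
  have hD : IsOpen D := Metric.isOpen_ball
  have hDc : IsPreconnected D := (convex_ball (0 : ℂ) _).isPreconnected
  have hO : IsOpen O := isOpen_lt continuous_const Complex.continuous_re
  -- holomorphy of the transforms (verbatim ★ P8 §2); `α₁`, `L` are holomorphic by hypothesis
  have hĥd : ∀ i, DifferentiableOn ℂ (ĥ i) D := fun i => (differentiable_integral_mul_borelHeight_cpow νG (hhc i) (hhs i)).differentiableOn
  have hĥa : ∀ i, AnalyticOnNhd ℂ (ĥ i) D := fun i => (hĥd i).analyticOnNhd hD
  -- the packaged `𝔛`-system with a finite-dimensional parameter (★ row 11b `exists_xSystem_finDim`) — `g`-free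
  haveI : CompleteSpace B := FiniteDimensional.complete ℂ B
  haveI : CompleteSpace ((I → HX F E c N k μ) × (HN F E c N k a μZ × X')) := inferInstance
  obtain ⟨A, c𝓦, hA, hc𝓦, hchar, hfinT⟩ := exists_xSystem_finDim (V₀ := fun i => HN F E c N k (a₀ i) μZ) hD T hĥd hcov (iota hb) (cnstN F E c N k a μZ) Q hα₁d hL φ₀
    (fun i => deltaShift (hs i)) (fun i => restrHN F E c N k (haa₀ i) μZ) (fun i => piN (hb₀ i) (hcl₀ i) (hinj₀ i)) hδι
    (fun i => piN_comp_restrHN_comp_iota (haa₀ i) hb (hb₀ i) (hcl₀ i) (hinj₀ i))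
    (fun i => isCompactOperator_deltaShift_comp_one_sub_cnstN (lt_of_lt_of_le ha (haa₀ i)) (hs i) (hm i) (hC i) (hK1 i))
  -- existence on the Godement set, uniqueness on `U₀`
  have hsol : ∀ z ∈ D ∩ O, A z ((fun z => (eX z, bX z)) z) = c𝓦 z := fun z hz =>
    (hchar z (eX z) (bX z)).2 ⟨hsolT z hz.1 hz.2, hsolC z hz.1 hz.2, hsolQ z hz.1 hz.2⟩
  obtain ⟨U₀, hU₀o, ⟨x₀, hx₀⟩, hU₀D, hU₀unq⟩ := hunq
  have hx : x₀ ∈ D ∩ O := hU₀D hx₀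
  have hunq' : ∃ U₀ : Set ℂ, IsOpen U₀ ∧ U₀.Nonempty ∧ U₀ ⊆ D ∩ O ∧ ∀ z ∈ U₀, ∀ w : HX F E c N k μ × B, A z w = c𝓦 z → w = (fun z => (eX z, bX z)) z := by
    refine ⟨U₀, hU₀o, ⟨x₀, hx₀⟩, hU₀D, fun z hz w hw => ?_⟩
    have hex : ∃! x : HX F E c N k μ × B, A z x = c𝓦 z :=
      xSystem_existsUnique_of_finDim hchar (hLinj z (hU₀D hz).1 (hU₀D hz).2) (hsol z (hU₀D hz)) fun ψ b hψb =>
        hU₀unq z hz ψ b ((hchar z ψ b).1 hψb).1 ((hchar z ψ b).1 hψb).2.1 ((hchar z ψ b).1 hψb).2.2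
    exact hex.unique hw (hsol z (hU₀D hz))
  -- Thm 2.3 with the holomorphy set kept
  obtain ⟨v, U, hUo, hUD, hcl, hUcd, hvU, hvmer, hsolU, hve⟩ := exists_solution_byproducts hD hDc hA hc𝓦 hfinT hsol hunq'
  -- the components
  have hfst : ∀ z, (v z).1 = (ContinuousLinearMap.fst ℂ (HX F E c N k μ) B) (v z) := fun z => rfl
  have hsnd : ∀ z, (v z).2 = (ContinuousLinearMap.snd ℂ (HX F E c N k μ) B) (v z) := fun z => rfl
  have hvXd : DifferentiableOn ℂ (fun z => (v z).1) U := (ContinuousLinearMap.fst ℂ (HX F E c N k μ) B).differentiable.comp_differentiableOn hvU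
  have hccd : DifferentiableOn ℂ (fun z => (v z).2) U := (ContinuousLinearMap.snd ℂ (HX F E c N k μ) B).differentiable.comp_differentiableOn hvU
  have hvXm : MeromorphicOn (fun z => (v z).1) D := fun z hz => (ContinuousLinearMap.fst ℂ (HX F E c N k μ) B).comp_meromorphicAt (hvmer z hz)
  have hccm : MeromorphicOn (fun z => (v z).2) D := fun z hz => (ContinuousLinearMap.snd ℂ (HX F E c N k μ) B).comp_meromorphicAt (hvmer z hz)
  -- the equations on `U` and uniqueness there
  have hsolv : ∀ z ∈ U, A z (v z) = c𝓦 z := fun z hz => (hsolU z hz (v z)).2 rfl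
  have heqs : ∀ z ∈ U, (∀ i, T i (v z).1 = ĥ i z • (v z).1) ∧ cnstN F E c N k a μZ (iota hb (v z).1) = φ₀ • α₁ z + L z (v z).2 ∧ Q (v z).1 = 0 :=
    fun z hz => (hchar z (v z).1 (v z).2).1 (hsolv z hz)
  refine ⟨U, fun z => (v z).1, fun z => (v z).2, hUo, hUD, hcl, hUcd, hvXd, hvXm, hccd, hccm, heqs, fun z hz ψ b h1 h2 h3 => ?_, fun z hz hz1 => ?_, fun Es Λ hΛ => ?_⟩
  · have hw : (ψ, b) = v z := (hsolU z hz (ψ, b)).1 ((hchar z ψ b).2 ⟨h1, h2, h3⟩)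
    exact ⟨congrArg Prod.fst hw, congrArg Prod.snd hw⟩
  · have hw : v z = (eX z, bX z) := hve z ⟨hz, hz1⟩
    exact ⟨congrArg Prod.fst hw, congrArg Prod.snd hw⟩
  -- the scalar piece: scalarise through an index `j₀` with `ĥ_{j₀}(0) ≠ 0`
  have h0D : (0 : ℂ) ∈ D := by rw [hDdef]; exact Metric.mem_ball_self (by positivity)
  obtain ⟨j₀, hj₀⟩ := hcov 0 h0D
  have hĥc : ∀ j, Continuous (ĥ j) := fun j => (differentiable_integral_mul_borelHeight_cpow νG (hhc j) (hhs j)).continuous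
  have hvXU : ∀ s ∈ U, σ₀ < s.re → (v s).1 = eX s := fun s hs hs1 => congrArg Prod.fst (hve s ⟨hs, hs1⟩)
  -- the local analytic germs `g_j := ĥ_j⁻¹ · Λ_j ∘ vX`, analytic on `U ∩ {ĥ_j ≠ 0}`, `= Es` on `U ∩ O` there
  have hgerm : ∀ j, ∀ z ∈ U, ĥ j z ≠ 0 → AnalyticAt ℂ (fun s => (ĥ j s)⁻¹ * Λ j (v s).1) z := by
    intro j z hz hjz
    have hva : AnalyticAt ℂ v z := hvU.analyticAt (hUo.mem_nhds hz)
    have h2 : AnalyticAt ℂ (fun s => Λ j (v s).1) z := ((Λ j ∘L ContinuousLinearMap.fst ℂ (HX F E c N k μ) B).analyticAt (v z)).comp hva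
    exact ((hĥa j z (hUD hz)).inv hjz).mul h2
  have hEq : ∀ j, ∀ s ∈ U, s ∈ D → σ₀ < s.re → ĥ j s ≠ 0 → (ĥ j s)⁻¹ * Λ j (v s).1 = Es s := by
    intro j s hsU hsD hs1 hjs
    rw [hvXU s hsU hs1, hΛ j s hsD hs1, inv_mul_cancel_left₀ hjs]
  -- the scalarisations `S j`, meromorphic on `D` as soon as `ĥ_j ≢ 0`
  have hSmer : ∀ j, ∀ z₁ ∈ D, ĥ j z₁ ≠ 0 → MeromorphicOn (fun z => if z ∈ O then Es z else (ĥ j z)⁻¹ * Λ j (v z).1) D := by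
    intro j z₁ hz₁ hjz₁
    refine meromorphicOn_scalarisation hvXm (Λ j) (hĥa j).meromorphicOn Es fun z₀ hz₀ => ?_
    filter_upwards [hUcd z₀ hz₀, eventually_ne_zero_of_analyticOnNhd hDc (hĥa j) hz₁ hjz₁ hz₀, mem_nhdsWithin_of_mem_nhds (hD.mem_nhds hz₀)] with s hsU hĥs hsD
    intro hsO
    exact ⟨hĥs, by rw [hvXU s hsU hsO, hΛ j s hsD hsO]⟩
  -- near a point of `U` where `ĥ_j ≠ 0`, every `S j'` (with `ĥ_{j'} ≢ 0`) is eventually the germ `g_j`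
  have hloc : ∀ j', ∀ z₁' ∈ D, ĥ j' z₁' ≠ 0 → ∀ j, ∀ z ∈ U, ĥ j z ≠ 0 →
      (fun z => if z ∈ O then Es z else (ĥ j' z)⁻¹ * Λ j' (v z).1) =ᶠ[𝓝[≠] z] fun s => (ĥ j s)⁻¹ * Λ j (v s).1 := by
    intro j' z₁' hz₁' hj'z₁' j z hz hjz
    -- a base point `z₁ ∈ U ∩ (D ∩ O)` with `ĥ_j(z₁) ≠ 0` (`D ∩ O` is non-empty: it contains `U₀ ∋ x₀`)
    have hVo : IsOpen ((D ∩ O) ∩ U) := (hD.inter hO).inter hUo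
    have hVne : ((D ∩ O) ∩ U).Nonempty := mem_closure_iff_nhds.1 (hcl hx.1) _ ((hD.inter hO).mem_nhds hx)
    obtain ⟨z₁, hz₁V, hjz₁⟩ := exists_mem_ne_zero_of_isOpen hDc (hĥa j) (hUD hz) hjz hVo (fun s hs => hs.1.1) hVne
    -- both pieces equal `Es` near `z₁`, and the germ `g_j` equals `Es` there too
    have hWo : IsOpen (((D ∩ O) ∩ U) ∩ {s | ĥ j s ≠ 0}) := hVo.inter (isOpen_ne_fun (hĥc j) continuous_const)
    have hW1 : ((D ∩ O) ∩ U) ∩ {s | ĥ j s ≠ 0} ∈ 𝓝 z₁ := hWo.mem_nhds ⟨hz₁V, hjz₁⟩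
    have hgerm₁ : AnalyticAt ℂ (fun s => (ĥ j s)⁻¹ * Λ j (v s).1) z₁ := hgerm j z₁ hz₁V.2 hjz₁
    have hf : (fun z => if z ∈ O then Es z else (ĥ j' z)⁻¹ * Λ j' (v z).1) =ᶠ[𝓝 z₁] fun s => (ĥ j s)⁻¹ * Λ j (v s).1 := by
      filter_upwards [hW1] with s hs
      rw [if_pos hs.1.1.2, hEq j s hs.1.2 hs.1.1.1 hs.1.1.2 hs.2]
    have hf' : (fun z => if z ∈ O then Es z else (ĥ j z)⁻¹ * Λ j (v z).1) =ᶠ[𝓝 z₁] fun s => (ĥ j s)⁻¹ * Λ j (v s).1 := by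
      filter_upwards [hW1] with s hs
      rw [if_pos hs.1.1.2, hEq j s hs.1.2 hs.1.1.1 hs.1.1.2 hs.2]
    have hNF := toMeromorphicNFOn_eqOn_of_eventuallyEq (subset_refl D) hDc (hSmer j' z₁' hz₁' hj'z₁') (hSmer j z (hUD hz) hjz) hz₁V.1.1 hgerm₁ hf hf'
    -- near `z`: `S j' = NF(S j') = NF(S j) = S j = g_j`
    have h1 : (fun z => if z ∈ O then Es z else (ĥ j' z)⁻¹ * Λ j' (v z).1) =ᶠ[𝓝[≠] z]
        toMeromorphicNFOn (fun z => if z ∈ O then Es z else (ĥ j' z)⁻¹ * Λ j' (v z).1) D :=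
      ((hSmer j' z₁' hz₁' hj'z₁').toMeromorphicNFOn_eq_self_on_nhdsNE (hUD hz)).symm
    have h2 : toMeromorphicNFOn (fun z => if z ∈ O then Es z else (ĥ j' z)⁻¹ * Λ j' (v z).1) D =ᶠ[𝓝[≠] z]
        toMeromorphicNFOn (fun z => if z ∈ O then Es z else (ĥ j z)⁻¹ * Λ j (v z).1) D :=
      (eventually_of_mem (hD.mem_nhds (hUD hz)) hNF).filter_mono nhdsWithin_le_nhds
    have h3 : toMeromorphicNFOn (fun z => if z ∈ O then Es z else (ĥ j z)⁻¹ * Λ j (v z).1) D =ᶠ[𝓝[≠] z]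
        (fun z => if z ∈ O then Es z else (ĥ j z)⁻¹ * Λ j (v z).1) :=
      (hSmer j z (hUD hz) hjz).toMeromorphicNFOn_eq_self_on_nhdsNE (hUD hz)
    have h4 : (fun z => if z ∈ O then Es z else (ĥ j z)⁻¹ * Λ j (v z).1) =ᶠ[𝓝[≠] z] fun s => (ĥ j s)⁻¹ * Λ j (v s).1 := by
      refine (eventually_of_mem ((hUo.inter ((isOpen_ne_fun (hĥc j) continuous_const).inter hD)).mem_nhds ⟨hz, hjz, hUD hz⟩) fun s hs => ?_).filter_mono
        nhdsWithin_le_nhds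
      show (if s ∈ O then Es s else (ĥ j s)⁻¹ * Λ j (v s).1) = (ĥ j s)⁻¹ * Λ j (v s).1
      by_cases hsO : s ∈ O
      · rw [if_pos hsO, hEq j s hs.1 hs.2.2 hsO hs.2.1]
      · rw [if_neg hsO]
    exact ((h1.trans h2).trans h3).trans h4
  refine ⟨fun z => if z ∈ O then Es z else (ĥ j₀ z)⁻¹ * Λ j₀ (v z).1, hSmer j₀ 0 h0D hj₀, fun z _ hz1 => by simp only [if_pos (show z ∈ O from hz1)],
    fun j z hz hjz => hloc j₀ 0 h0D hj₀ j z hz hjz, fun z hz => ?_⟩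
  obtain ⟨j, hjz⟩ := hcov z (hUD hz)
  rw [meromorphicOrderAt_congr (hloc j₀ 0 h0D hj₀ j z hz hjz)]
  exact (hgerm j z hz hjz).meromorphicOrderAt_nonneg

end Summit.HodgeConjecture.HodgeConjecture.Cruxes.H413.K2E1ChiEisensteinMeromorphicExportsU2

end
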